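import Summits.SmoothPoincare4.SmoothPoincare4.Theorems.WeakReductionDescentDependentTripleGenusThreeStandardExactnessAux1
import Summits.SmoothPoincare4.SmoothPoincare4.Theorems.WeakReductionDescentDependentTripleGenusThreeStandardExactnessAux2
import Summits.SmoothPoincare4.SmoothPoincare4.Theorems.WeakReductionDescentDependentTripleGenusThreeStandardAnnularChartPushoff
import Summits.SmoothPoincare4.SmoothPoincare4.Theorems.WeakReductionDescentDependentTripleGenusThreeStandardStubBoundsDiscOfAnnularChart
import Summits.SmoothPoincare4.SmoothPoincare4.Theorems.WeakReductionDescentDependentTripleGenusThreeStandardRoundCircleCurve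
import Summits.SmoothPoincare4.SmoothPoincare4.Theses.WeakReductionDescent
import Literature.Topology.FourManifolds.DependentTripleGenusThreeTrisectionsProofs
import Literature.Topology.FourManifolds.HomotopyS4OrientableProofs
import HarnessLib

/-!
# Crux `WeakReductionDescent.DependentTripleGenusThreeStandard` (stmt-SmoothPoincare4-18000), line
# `Sketch`: the EXACTNESS lemma — a weak reduction of a trisection gives a dependent triple

Helper file (`--supports stmt-SmoothPoincare4-18000`) of the registered skeleton
`Cruxes/DependentTripleGenusThreeStandard/Lines/Sketch.lean`, proving VERBATIM its registered
helper `helper_hasDependentTriple_of_isWeaklyReducible`: for a Gay–Kirby trisection `T` of an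
ORIENTABLE smooth `4`-manifold `M`, a weak reduction `(c; c′)` (`Trisection.IsWeaklyReducible T`:
disjoint non-separating curves, `c` compressing in `H_p`, `c′` in the two other handlebodies of
the spine) yields Aranda–Zupan's DEPENDENT TRIPLE (`Trisection.HasDependentTriple T`): `c`, `c′`
and a parallel push-off `c₂` of `c′` — arXiv:2503.04607, p. 2, "we prove a stronger version of
Theorem 1.3" (Thm. 1.4 ⊇ Thm. 1.3).  With it the route item `GenusThreeBase` (AZ25 Thm. 1.3,
homotopy-sphere corollary) follows from the crux `DependentTripleGenusThreeStandard` (AZ25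
Thm. 1.4, homotopy-sphere corollary): `genusThreeBase_of_dependentTripleGenusThreeStandard`.

Proof (everything proved in the tree):

* `helper_exists_annularChart_pushoff` (`…AnnularChartPushoff.lean`): an annular chart
  `ψ : ℝ² → M` of the central surface `F` around `c′ = ψ(r₀ 𝕊¹)` (smooth, injective, immersive
  into `M` on `{r_lo < ‖x‖ < r_hi}`, image in `F`);
* SHRINK (`exists_nhd_roundCircle_forall_notMem`): `c` is compact, hence closed, and misses
  `c′`, so by compactness of the circle (`IsCompact.eventually_forall_of_forall_eventually`) a
  whole round band `{r₀ - ε < ‖x‖ < r₀ + ε}` is mapped off `c`; the third curve is the round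
  circle `c₂ = ψ(r 𝕊¹)`, `r = r₀ + ε/2`: a curve (`helper_isCurve_roundCircle_of_annularChart`),
  disjoint from `c` (shrink) and from `c′` (injectivity), compressing wherever `c′` does
  (`stub_boundsDisc_of_annularChart`, radii `r₀ → r`), non-separating
  (`helper_isNonSeparating_roundCircle_of_annularChart`, Aux2);
* SEPARATION (`not_isPreconnected_sdiff_of_annularChart`): the open band
  `B = ψ({r₀ < ‖x‖ < r})` lies in `S = F ∖ (c ∪ c′ ∪ c₂)`, is open in `F`
  (`helper_exists_isOpen_inter_eq_image_of_annularChart`, Aux1: invariance of domain for the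
  equidimensional immersion `ψ` read in the abstract surface `∂H`), and the compact image of the
  closed band meets `S` in `B` only; a chart point just outside the closed band is in `S ∖ B`, so
  `S` is covered by two disjoint relatively open nonempty pieces and is not preconnected;
* ASSEMBLY (`hasDependentTriple_of_weakReduction_pushoff`): relabel `(c, c′, c₂)` according to
  `p` (`fin_cases`).

No definitions, no named facts.

References: R. Aranda, A. Zupan, arXiv:2503.04607 (2025), p. 2 (Thms. 1.3, 1.4, dependent
triples), §2 p. 6 and Remark 2.5, §7 p. 24; M. W. Hirsch, *Differential Topology* (1976), Ch. 1
§3, Ch. 4 §5, Ch. 8 §§1–2; D. Gay, R. Kirby, Geom. Topol. 20 (2016), Def. 1.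
-/

-- the registered namespace `Summit.SmoothPoincare4.SmoothPoincare4.Theorems…` repeats a component
set_option linter.dupNamespace false

noncomputable section

open scoped Manifold ContDiff Topology
open Set Function Metric
open Literature.Topology.FourManifolds
open Literature.Topology.FourManifolds.Trisection

namespace Summit.SmoothPoincare4.SmoothPoincare4.Theorems

/-! ### Plane geometry of round bands -/

/-- Polar decomposition: a nonzero plane vector is `‖x‖ • u` for a unit vector `u`. [folklore] -/
theorem exists_norm_smul_sphere_eq {x : EuclideanSpace ℝ (Fin 2)} (hx : 0 < ‖x‖) :
    ∃ u : Metric.sphere (0 : EuclideanSpace ℝ (Fin 2)) 1,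
      ‖x‖ • (u : EuclideanSpace ℝ (Fin 2)) = x := by
  refine ⟨⟨‖x‖⁻¹ • x, ?_⟩, ?_⟩
  · rw [mem_sphere_zero_iff_norm, norm_smul, norm_inv, norm_norm, inv_mul_cancel₀ hx.ne']
  · show ‖x‖ • (‖x‖⁻¹ • x) = x
    rw [smul_smul, mul_inv_cancel₀ hx.ne', one_smul]

/-- The norm of `s • u` for a unit vector `u` and `0 ≤ s` is `s`. [folklore] -/
theorem norm_smul_sphere_eq {s : ℝ} (hs : 0 ≤ s)
    (u : Metric.sphere (0 : EuclideanSpace ℝ (Fin 2)) 1) :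
    ‖s • (u : EuclideanSpace ℝ (Fin 2))‖ = s := by
  rw [norm_smul, Real.norm_of_nonneg hs, norm_eq_of_mem_sphere u, mul_one]

/-- **Shrinking a round band off a closed set.** If `ψ` is continuous on the open annulus
`{r_lo < ‖x‖ < r_hi}` and the round circle `ψ(r₀ 𝕊¹)` (`r_lo < r₀ < r_hi`, `0 < r₀`) misses the
closed set `C`, then a whole round band `{r₀ - ε < ‖x‖ < r₀ + ε}` inside the annulus is mapped
off `C` (compactness of the circle: `IsCompact.eventually_forall_of_forall_eventually`).
[folklore] -/
theorem exists_nhd_roundCircle_forall_notMem {M : Type} [TopologicalSpace M]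
    {ψ : EuclideanSpace ℝ (Fin 2) → M} {rlo rhi r₀ : ℝ}
    (hcont : ContinuousOn ψ {x | rlo < ‖x‖ ∧ ‖x‖ < rhi}) (h₀ : 0 < r₀) (hlo : rlo < r₀)
    (hhi : r₀ < rhi) {C : Set M} (hC : IsClosed C)
    (hdisj : ∀ x : Metric.sphere (0 : EuclideanSpace ℝ (Fin 2)) 1,
      ψ (r₀ • (x : EuclideanSpace ℝ (Fin 2))) ∉ C) :
    ∃ ε : ℝ, 0 < ε ∧ ε ≤ r₀ ∧ r₀ + ε ≤ rhi ∧ rlo ≤ r₀ - ε ∧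
      ∀ x : EuclideanSpace ℝ (Fin 2), r₀ - ε < ‖x‖ → ‖x‖ < r₀ + ε → ψ x ∉ C := by
  set A : Set (EuclideanSpace ℝ (Fin 2)) := {x | rlo < ‖x‖ ∧ ‖x‖ < rhi} with hA_def
  have hAo : IsOpen A :=
    (isOpen_lt continuous_const continuous_norm).inter (isOpen_lt continuous_norm continuous_const)
  have hsmul : Continuous fun q : ℝ × EuclideanSpace ℝ (Fin 2) => q.1 • q.2 :=
    continuous_fst.smul continuous_snd
  have hev : ∀ᶠ t in 𝓝 r₀, ∀ y ∈ Metric.sphere (0 : EuclideanSpace ℝ (Fin 2)) 1,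
      ψ (t • y) ∉ C := by
    apply (isCompact_sphere (0 : EuclideanSpace ℝ (Fin 2)) 1).eventually_forall_of_forall_eventually
    intro y hy
    have hy0 : r₀ • y ∈ A := by
      have hn : ‖r₀ • y‖ = r₀ := norm_smul_sphere_eq h₀.le ⟨y, hy⟩
      exact ⟨by rw [hn]; exact hlo, by rw [hn]; exact hhi⟩
    have hψat : ContinuousAt ψ (r₀ • y) := hcont.continuousAt (hAo.mem_nhds hy0)
    have hcomp : ContinuousAt (fun q : ℝ × EuclideanSpace ℝ (Fin 2) => ψ (q.1 • q.2)) (r₀, y) :=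
      ContinuousAt.comp (f := fun q : ℝ × EuclideanSpace ℝ (Fin 2) => q.1 • q.2) hψat
        hsmul.continuousAt
    exact hcomp.preimage_mem_nhds (hC.isOpen_compl.mem_nhds (hdisj ⟨y, hy⟩))
  obtain ⟨ε, hε, hball⟩ := Metric.eventually_nhds_iff.1 hev
  set ε' : ℝ := min ε (min r₀ (min (rhi - r₀) (r₀ - rlo))) with hε'_def
  have h1 : ε' ≤ ε := min_le_left _ _
  have h2 : ε' ≤ r₀ := (min_le_right _ _).trans (min_le_left _ _)
  have h3 : ε' ≤ rhi - r₀ :=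
    ((min_le_right _ _).trans (min_le_right _ _)).trans (min_le_left _ _)
  have h4 : ε' ≤ r₀ - rlo :=
    ((min_le_right _ _).trans (min_le_right _ _)).trans (min_le_right _ _)
  have hε' : 0 < ε' := lt_min hε (lt_min h₀ (lt_min (by linarith) (by linarith)))
  refine ⟨ε', hε', h2, by linarith, by linarith, fun x hx1 hx2 => ?_⟩
  have hxpos : 0 < ‖x‖ := by linarith
  obtain ⟨u, hu⟩ := exists_norm_smul_sphere_eq hxpos
  have hdist : dist ‖x‖ r₀ < ε := by
    rw [Real.dist_eq, abs_sub_lt_iff]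
    constructor <;> linarith
  have key := hball hdist (u : EuclideanSpace ℝ (Fin 2)) u.2
  rwa [hu] at key

/-! ### The separation argument -/

/-- **An open round band of an annular chart separates the central surface cut along a set
`c` off the band and the two boundary circles of the band region.**  For an annular chart `ψ`
of `F = centralSurfaceSet T` and radii `r_lo < r₀ < r < r′ < r_hi` (`0 < r₀`) such that the closed
band `{r₀ ≤ ‖x‖ ≤ r′}` is mapped off `c`, the set `F ∖ (c ∪ ψ(r₀ 𝕊¹) ∪ ψ(r 𝕊¹))` is not
preconnected: the open band `ψ({r₀ < ‖x‖ < r})` is a nonempty, proper, relatively clopen subset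
(open by `helper_exists_isOpen_inter_eq_image_of_annularChart`, closed since the image of the
compact closed band adds only points of the two circles).
[cite: ArandaZupan2025, p. 2 (dependent triples) and §7 (p. 24)] -/
theorem not_isPreconnected_sdiff_of_annularChart {M : Type} [TopologicalSpace M] [T2Space M]
    [SecondCountableTopology M] [ChartedSpace (EuclideanSpace ℝ (Fin 4)) M]
    [IsManifold (𝓡 4) ∞ M] {g : ℕ} {k : Fin 3 → ℕ} {T : Fin 3 → Set M}
    (hT : IsGKTrisection M g k T) {ψ : EuclideanSpace ℝ (Fin 2) → M} {rlo rhi : ℝ}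
    (hs : ContMDiffOn (𝓡 2) (𝓡 4) ∞ ψ {x | rlo < ‖x‖ ∧ ‖x‖ < rhi})
    (hinj : InjOn ψ {x | rlo < ‖x‖ ∧ ‖x‖ < rhi})
    (himm : ∀ x : EuclideanSpace ℝ (Fin 2), rlo < ‖x‖ → ‖x‖ < rhi →
      Injective (mfderiv (𝓡 2) (𝓡 4) ψ x))
    (hψF : ψ '' {x | rlo < ‖x‖ ∧ ‖x‖ < rhi} ⊆ centralSurfaceSet T)
    {r₀ r r' : ℝ} (h₀ : 0 < r₀) (hlo : rlo < r₀) (h₀r : r₀ < r) (hrr' : r < r') (hhi : r' < rhi)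
    {c : Set M} (hc : ∀ x : EuclideanSpace ℝ (Fin 2), r₀ ≤ ‖x‖ → ‖x‖ ≤ r' → ψ x ∉ c) :
    ¬ IsPreconnected (centralSurfaceSet T \
      (c ∪ (Set.range fun x : Metric.sphere (0 : EuclideanSpace ℝ (Fin 2)) 1 =>
          ψ (r₀ • (x : EuclideanSpace ℝ (Fin 2)))) ∪
        Set.range fun x : Metric.sphere (0 : EuclideanSpace ℝ (Fin 2)) 1 =>
          ψ (r • (x : EuclideanSpace ℝ (Fin 2))))) := by
  intro hpre
  set A : Set (EuclideanSpace ℝ (Fin 2)) := {x | rlo < ‖x‖ ∧ ‖x‖ < rhi} with hA_def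
  set c₀ : Set M := Set.range fun x : Metric.sphere (0 : EuclideanSpace ℝ (Fin 2)) 1 =>
    ψ (r₀ • (x : EuclideanSpace ℝ (Fin 2))) with hc₀_def
  set c₁ : Set M := Set.range fun x : Metric.sphere (0 : EuclideanSpace ℝ (Fin 2)) 1 =>
    ψ (r • (x : EuclideanSpace ℝ (Fin 2))) with hc₁_def
  set S : Set M := centralSurfaceSet T \ (c ∪ c₀ ∪ c₁) with hS_def
  have hr : 0 < r := h₀.trans h₀r
  have hrhi : r < rhi := hrr'.trans hhi
  have hmemA : ∀ {s : ℝ}, 0 ≤ s → rlo < s → s < rhi →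
      ∀ u : Metric.sphere (0 : EuclideanSpace ℝ (Fin 2)) 1,
        s • (u : EuclideanSpace ℝ (Fin 2)) ∈ A := fun hs0 hslo hshi u => by
    simp only [hA_def, mem_setOf_eq, norm_smul_sphere_eq hs0]
    exact ⟨hslo, hshi⟩
  -- a chart point of norm `s` lies on the round circle of radius `s`
  have hcirc : ∀ {s : ℝ}, 0 < s → ∀ x : EuclideanSpace ℝ (Fin 2), ‖x‖ = s →
      ψ x ∈ Set.range fun u : Metric.sphere (0 : EuclideanSpace ℝ (Fin 2)) 1 =>
        ψ (s • (u : EuclideanSpace ℝ (Fin 2))) := by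
    intro s hs x hx
    obtain ⟨u, hu⟩ := exists_norm_smul_sphere_eq (x := x) (by rw [hx]; exact hs)
    refine ⟨u, ?_⟩
    show ψ (s • (u : EuclideanSpace ℝ (Fin 2))) = ψ x
    rw [← hx, hu]
  -- a chart point of norm `≠ s` is off the round circle of radius `s`
  have hoff : ∀ {s : ℝ}, 0 ≤ s → rlo < s → s < rhi → ∀ x ∈ A, ‖x‖ ≠ s →
      ψ x ∉ Set.range fun u : Metric.sphere (0 : EuclideanSpace ℝ (Fin 2)) 1 =>
        ψ (s • (u : EuclideanSpace ℝ (Fin 2))) := by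
    rintro s hs0 hslo hshi x hxA hne ⟨u, hu⟩
    have hux : s • (u : EuclideanSpace ℝ (Fin 2)) = x := hinj (hmemA hs0 hslo hshi u) hxA hu
    exact hne (by rw [← hux, norm_smul_sphere_eq hs0])
  -- membership in `S` of chart points of the band `r₀ < ‖x‖ ≤ r'`, `‖x‖ ≠ r`
  have hmemS : ∀ x ∈ A, r₀ < ‖x‖ → ‖x‖ ≤ r' → ‖x‖ ≠ r → ψ x ∈ S := fun x hxA hx1 hx2 hx3 =>
    ⟨hψF ⟨x, hxA, rfl⟩, fun hx => by
      rcases hx with (hx | hx) | hx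
      · exact hc x hx1.le hx2 hx
      · exact hoff h₀.le hlo (h₀r.trans hrhi) x hxA hx1.ne' hx
      · exact hoff hr.le (hlo.trans h₀r) hrhi x hxA hx3 hx⟩
  -- the open band, open in `F`
  set V : Set (EuclideanSpace ℝ (Fin 2)) := {x | r₀ < ‖x‖ ∧ ‖x‖ < r} with hV_def
  have hVo : IsOpen V :=
    (isOpen_lt continuous_const continuous_norm).inter (isOpen_lt continuous_norm continuous_const)
  have hVA : V ⊆ A := fun x hx => ⟨hlo.trans hx.1, hx.2.trans hrhi⟩
  obtain ⟨O, hOo, hOF⟩ :=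
    helper_exists_isOpen_inter_eq_image_of_annularChart M g k T hT ψ rlo rhi hs hinj himm hψF V
      hVo hVA
  -- the closed band, with compact (hence closed) image
  set K : Set (EuclideanSpace ℝ (Fin 2)) := {x | r₀ ≤ ‖x‖ ∧ ‖x‖ ≤ r} with hK_def
  have hKA : K ⊆ A := fun x hx => ⟨hlo.trans_le hx.1, hx.2.trans_lt hrhi⟩
  have hKc : IsCompact K :=
    (isCompact_closedBall (0 : EuclideanSpace ℝ (Fin 2)) r).of_isClosed_subset
      ((isClosed_le continuous_const continuous_norm).inter
        (isClosed_le continuous_norm continuous_const))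
      (fun x hx => mem_closedBall_zero_iff.2 hx.2)
  have hKimg : IsClosed (ψ '' K) :=
    (hKc.image_of_continuousOn (hs.continuousOn.mono hKA)).isClosed
  set x₀ : Metric.sphere (0 : EuclideanSpace ℝ (Fin 2)) 1 :=
    ⟨EuclideanSpace.single 0 1, by simp⟩ with hx₀_def
  -- (b) `S` meets `O`: the chart point at radius `(r₀ + r) / 2`
  have hSO : (S ∩ O).Nonempty := by
    have hm₀ : r₀ < (r₀ + r) / 2 := by linarith
    have hm₁ : (r₀ + r) / 2 < r := by linarith
    have hm : 0 ≤ (r₀ + r) / 2 := by linarith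
    have hxA : ((r₀ + r) / 2) • (x₀ : EuclideanSpace ℝ (Fin 2)) ∈ A :=
      hmemA hm (hlo.trans hm₀) (hm₁.trans hrhi) x₀
    refine ⟨ψ (((r₀ + r) / 2) • (x₀ : EuclideanSpace ℝ (Fin 2))),
      hmemS _ hxA (by rw [norm_smul_sphere_eq hm]; exact hm₀)
        (by rw [norm_smul_sphere_eq hm]; linarith)
        (by rw [norm_smul_sphere_eq hm]; exact hm₁.ne), ?_⟩
    have hmem : ψ (((r₀ + r) / 2) • (x₀ : EuclideanSpace ℝ (Fin 2))) ∈ O ∩ centralSurfaceSet T := by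
      rw [hOF]
      refine ⟨_, ⟨?_, ?_⟩, rfl⟩
      · rw [norm_smul_sphere_eq hm]; exact hm₀
      · rw [norm_smul_sphere_eq hm]; exact hm₁
    exact hmem.1
  -- (c) `S` meets the complement of `ψ(K)`: the chart point at radius `(r + r') / 2`
  have hSK : (S ∩ (ψ '' K)ᶜ).Nonempty := by
    have hM₀ : r < (r + r') / 2 := by linarith
    have hM₁ : (r + r') / 2 < r' := by linarith
    have hMn : 0 ≤ (r + r') / 2 := by linarith
    have hxA : ((r + r') / 2) • (x₀ : EuclideanSpace ℝ (Fin 2)) ∈ A :=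
      hmemA hMn (hlo.trans (h₀r.trans hM₀)) (hM₁.trans hhi) x₀
    refine ⟨ψ (((r + r') / 2) • (x₀ : EuclideanSpace ℝ (Fin 2))),
      hmemS _ hxA (by rw [norm_smul_sphere_eq hMn]; linarith)
        (by rw [norm_smul_sphere_eq hMn]; exact hM₁.le)
        (by rw [norm_smul_sphere_eq hMn]; exact hM₀.ne'), ?_⟩
    rintro ⟨x, hxK, hx⟩
    have hxe : x = ((r + r') / 2) • (x₀ : EuclideanSpace ℝ (Fin 2)) := hinj (hKA hxK) hxA hx
    have hxn : ‖x‖ = (r + r') / 2 := by rw [hxe, norm_smul_sphere_eq hMn]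
    linarith [hxK.2]
  -- (a) `S ⊆ O ∪ ψ(K)ᶜ`
  have hcover : S ⊆ O ∪ (ψ '' K)ᶜ := by
    intro z hz
    by_cases hzK : z ∈ ψ '' K
    · left
      obtain ⟨x, hxK, rfl⟩ := hzK
      have hx₀ : ‖x‖ ≠ r₀ := fun hxr => hz.2 (Or.inl (Or.inr (hcirc h₀ x hxr)))
      have hx₁ : ‖x‖ ≠ r := fun hxr => hz.2 (Or.inr (hcirc hr x hxr))
      have hxV : x ∈ V := ⟨lt_of_le_of_ne hxK.1 (Ne.symm hx₀), lt_of_le_of_ne hxK.2 hx₁⟩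
      have hmem : ψ x ∈ O ∩ centralSurfaceSet T := by rw [hOF]; exact ⟨x, hxV, rfl⟩
      exact hmem.1
    · right
      exact hzK
  -- (d) `S ∩ O ∩ ψ(K)ᶜ = ∅`
  have hempty : ¬ (S ∩ (O ∩ (ψ '' K)ᶜ)).Nonempty := by
    rintro ⟨z, hzS, hzO, hzK⟩
    have hmem : z ∈ O ∩ centralSurfaceSet T := ⟨hzO, hzS.1⟩
    rw [hOF] at hmem
    obtain ⟨x, hxV, rfl⟩ := hmem
    exact hzK ⟨x, ⟨hxV.1.le, hxV.2.le⟩, rfl⟩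
  exact hempty (hpre O (ψ '' K)ᶜ hOo hKimg.isOpen_compl hcover hSO hSK)

/-! ### Assembly -/

/-- **Relabelling**: a weak reduction `(c; c′)` at the handlebody `H_p` together with a third
curve `c₂` compressing, like `c′`, in both other handlebodies, the three curves pairwise
disjoint, non-separating and jointly separating, is a dependent triple (`fin_cases p`).
[cite: ArandaZupan2025, p. 2 (definition of a dependent triple)] -/
theorem hasDependentTriple_of_weakReduction_pushoff {M : Type} [TopologicalSpace M]
    [ChartedSpace (EuclideanSpace ℝ (Fin 4)) M] {T : Fin 3 → Set M} (p : Fin 3)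
    {c c' c₂ : Set M} (hc : IsCurve T c) (hc' : IsCurve T c') (hc₂ : IsCurve T c₂)
    (h1 : Disjoint c c') (h2 : Disjoint c c₂) (h3 : Disjoint c' c₂)
    (hn : IsNonSeparating T c) (hn' : IsNonSeparating T c') (hn₂ : IsNonSeparating T c₂)
    (hd : BoundsDisc T (spineHandlebody T p) c)
    (hd' : ∀ q : Fin 3, q ≠ p → BoundsDisc T (spineHandlebody T q) c')
    (hd₂ : ∀ q : Fin 3, q ≠ p → BoundsDisc T (spineHandlebody T q) c₂)
    (hsep : ¬ IsPreconnected (centralSurfaceSet T \ (c ∪ c' ∪ c₂))) :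
    HasDependentTriple T := by
  fin_cases p
  · exact ⟨c, c', c₂, hc, hc', hc₂, h1, h3, h2, hn, hn', hn₂, hd, hd' 1 (by decide),
      hd₂ 2 (by decide), hsep⟩
  · refine ⟨c', c, c₂, hc', hc, hc₂, h1.symm, h2, h3, hn', hn, hn₂, hd' 0 (by decide), hd,
      hd₂ 2 (by decide), ?_⟩
    rwa [union_comm c' c]
  · refine ⟨c', c₂, c, hc', hc₂, hc, h3, h2.symm, h1.symm, hn', hn₂, hn, hd' 0 (by decide),
      hd₂ 1 (by decide), hd, ?_⟩
    rwa [union_right_comm, union_comm c' c]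

/-! ### The exactness lemma -/

/-- **REGISTERED helper `helper_hasDependentTriple_of_isWeaklyReducible` (line `Sketch`): a weak
reduction of a Gay–Kirby trisection of an orientable smooth `4`-manifold gives a dependent
triple** — the weak reduction `(c; c′)` together with a parallel push-off `c₂` of `c′` (Aranda–Zupan
2025, p. 2: Thm. 1.4 is "a stronger version of Theorem 1.3").  See the module docstring for the
proof. [cite: ArandaZupan2025, p. 2 (Thms. 1.3, 1.4; definition of a dependent triple)] -/
theorem helper_hasDependentTriple_of_isWeaklyReducible :
    ∀ (M : Type) [TopologicalSpace M] [T2Space M] [SecondCountableTopology M]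
      [ChartedSpace (EuclideanSpace ℝ (Fin 4)) M] [IsManifold (𝓡 4) ∞ M],
      IsOrientable (𝓡 4) M →
      ∀ (g : ℕ) (k : Fin 3 → ℕ) (T : Fin 3 → Set M), IsGKTrisection M g k T →
      IsWeaklyReducible T → HasDependentTriple T := by
  intro M _ _ _ _ _ ho g k T hT hW
  obtain ⟨p, c, c', hc, hc', hcc', hnc, hnc', hdc, hdc'⟩ := hW
  -- `c` is compact, hence closed, and `c′ ⊆ cᶜ`
  have hcclosed : IsClosed c := by
    obtain ⟨-, γ, hγ, hγc⟩ := hc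
    rw [← hγc]
    exact (isCompact_range hγ.contMDiff.continuous).isClosed
  have hc'U : c' ⊆ cᶜ := hcc'.subset_compl_left
  -- an annular chart around `c′`
  obtain ⟨-, -, -, -, ψ, rlo, r₀, r₁, rhi, h₀, -, hlo₀, -, hhi₀, -, hs, hinj, himm, hψF, hr₀, -⟩ :=
    helper_exists_annularChart_pushoff M ho g k T hT c' hc' cᶜ hcclosed.isOpen_compl hc'U
  subst hr₀
  -- shrink a round band around `c′` off `c`
  have hdisj : ∀ x : Metric.sphere (0 : EuclideanSpace ℝ (Fin 2)) 1,
      ψ (r₀ • (x : EuclideanSpace ℝ (Fin 2))) ∉ c := fun x hx =>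
    Set.disjoint_left.1 hcc' hx ⟨x, rfl⟩
  obtain ⟨ε, hε, hεr₀, hεhi, hεlo, hεc⟩ :=
    exists_nhd_roundCircle_forall_notMem hs.continuousOn h₀ hlo₀ hhi₀ hcclosed hdisj
  -- the third curve: the round circle of radius `r = r₀ + ε / 2`
  have h₀r : r₀ < r₀ + ε / 2 := by linarith
  have hr : 0 < r₀ + ε / 2 := by linarith
  have hlor : rlo < r₀ + ε / 2 := by linarith
  have hrhi : r₀ + ε / 2 < rhi := by linarith
  set c₂ : Set M := Set.range fun x : Metric.sphere (0 : EuclideanSpace ℝ (Fin 2)) 1 =>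
    ψ ((r₀ + ε / 2) • (x : EuclideanSpace ℝ (Fin 2))) with hc₂_def
  have hc₂ : IsCurve T c₂ :=
    helper_isCurve_roundCircle_of_annularChart M T ψ rlo rhi hs hinj himm hψF (r₀ + ε / 2) hr
      hlor hrhi
  -- `c₂` compresses wherever `c′` does (disc transport across the chart)
  have hdc₂ : ∀ q : Fin 3, q ≠ p → BoundsDisc T (spineHandlebody T q) c₂ := fun q hq =>
    stub_boundsDisc_of_annularChart M g k T hT q _ c₂ hc' hc₂
      ⟨ψ, rlo, r₀, r₀ + ε / 2, rhi, h₀, hr, hlo₀, hlor, hhi₀, hrhi, hs, hinj, himm, hψF, rfl, rfl⟩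
      (hdc' q hq)
  -- `c₂` is non-separating like `c′`
  have hnc₂ : IsNonSeparating T c₂ :=
    helper_isNonSeparating_roundCircle_of_annularChart M g k T hT ψ rlo r₀ (r₀ + ε / 2) rhi h₀
      hr hlo₀ hlor hhi₀ hrhi hs hinj himm hψF hnc'
  -- disjointness
  have hmemA : ∀ {s : ℝ}, 0 ≤ s → rlo < s → s < rhi →
      ∀ u : Metric.sphere (0 : EuclideanSpace ℝ (Fin 2)) 1,
        s • (u : EuclideanSpace ℝ (Fin 2)) ∈ {x : EuclideanSpace ℝ (Fin 2) | rlo < ‖x‖ ∧ ‖x‖ < rhi} :=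
    fun hs0 hslo hshi u => by
      simp only [mem_setOf_eq, norm_smul_sphere_eq hs0]
      exact ⟨hslo, hshi⟩
  have hcc₂ : Disjoint c c₂ := by
    refine Set.disjoint_left.2 fun a ha hac₂ => ?_
    obtain ⟨x, rfl⟩ := hac₂
    exact hεc _ (by rw [norm_smul_sphere_eq hr.le]; linarith)
      (by rw [norm_smul_sphere_eq hr.le]; linarith) ha
  have hc'c₂ : Disjoint (Set.range fun x : Metric.sphere (0 : EuclideanSpace ℝ (Fin 2)) 1 =>
      ψ (r₀ • (x : EuclideanSpace ℝ (Fin 2)))) c₂ := by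
    refine Set.disjoint_left.2 ?_
    rintro _ ⟨x, rfl⟩ ⟨y, hy⟩
    have hxy : (r₀ + ε / 2) • (y : EuclideanSpace ℝ (Fin 2)) = r₀ • (x : EuclideanSpace ℝ (Fin 2)) :=
      hinj (hmemA hr.le hlor hrhi y) (hmemA h₀.le hlo₀ hhi₀ x) hy
    have hn := congrArg (fun v : EuclideanSpace ℝ (Fin 2) => ‖v‖) hxy
    simp only [norm_smul_sphere_eq hr.le, norm_smul_sphere_eq h₀.le] at hn
    linarith
  -- separation: the closed band `{r₀ ≤ ‖x‖ ≤ r₀ + 3ε/4}` is mapped off `c`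
  have hsep : ¬ IsPreconnected (centralSurfaceSet T \
      (c ∪ (Set.range fun x : Metric.sphere (0 : EuclideanSpace ℝ (Fin 2)) 1 =>
          ψ (r₀ • (x : EuclideanSpace ℝ (Fin 2)))) ∪ c₂)) :=
    not_isPreconnected_sdiff_of_annularChart hT hs hinj himm hψF (r' := r₀ + 3 * ε / 4) h₀ hlo₀
      h₀r (by linarith) (by linarith) fun x hx1 hx2 => hεc x (by linarith) (by linarith)
  exact hasDependentTriple_of_weakReduction_pushoff p hc hc' hc₂ hcc' hcc₂ hc'c₂ hnc hnc' hnc₂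
    hdc hdc' hdc₂ hsep

/-! ### The route corollary: `GenusThreeBase` from `DependentTripleGenusThreeStandard` -/

/-- **Aranda–Zupan Thm. 1.3 (homotopy-sphere corollary, route item `GenusThreeBase`) follows from
Thm. 1.4 (homotopy-sphere corollary, crux `DependentTripleGenusThreeStandard`)**: a bare
`M ≃ₕ S⁴` is orientable (`isOrientable_of_homotopyEquiv_sphere_four_holds`, Lee Thm. 15.43), the
route's inline weak-reducibility block is `Trisection.IsWeaklyReducible T` and its inline
dependent-triple block is `Trisection.HasDependentTriple T` (both by `rfl`), and the exactness
lemma `helper_hasDependentTriple_of_isWeaklyReducible` turns the former into the latter.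
[cite: ArandaZupan2025, p. 2 (Thm. 1.4 "a stronger version of Theorem 1.3")] -/
theorem genusThreeBase_of_dependentTripleGenusThreeStandard :
    Summit.SmoothPoincare4.SmoothPoincare4.Theses.WeakReductionDescent.DependentTripleGenusThreeStandard →
      Summit.SmoothPoincare4.SmoothPoincare4.Theses.WeakReductionDescent.GenusThreeBase := by
  intro hDT
  unfold Summit.SmoothPoincare4.SmoothPoincare4.Theses.WeakReductionDescent.GenusThreeBase
  intro M _ _ _ _ _ e k T hT hwr
  have ho : IsOrientable (𝓡 4) M := isOrientable_of_homotopyEquiv_sphere_four_holds M e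
  have hW : IsWeaklyReducible T := (isWeaklyReducible_iff T).2 hwr
  have hD : HasDependentTriple T := helper_hasDependentTriple_of_isWeaklyReducible M ho 3 k T hT hW
  exact hDT M e k T hT ((hasDependentTriple_iff T).1 hD)

end Summit.SmoothPoincare4.SmoothPoincare4.Theorems

end
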